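import Summits.CriticalPhenomena.PercolationContinuityZ3.Theorems.Transplant.BoxProdZdTubes
import Summits.CriticalPhenomena.PercolationContinuityZ3.Theorems.Transplant.HeisenbergABBANeg
import Summits.CriticalPhenomena.PercolationContinuityZ3.Theorems.Transplant.HeisenbergSlabA
import HarnessLib

/-!
# `Cay(H₃(ℤ); S) × ℤ` IS A SINGLE-TYPE CUSTOMER OF THE D″ v2 NODE for every symmetric unit-step generating set `S ∋ a, b` of the
# Heisenberg group admitting ONE automorphism reversing the `a`-coordinate — in particular for `S = {a, b, ab, ba}^±`, whose own
# Cayley graph is only tier 3b (`HeisenbergABBANeg`)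

builds on p205010 (kernel theorem, internal audit signed; external expert review pending) — nothing in this file uses p205010.
Lane `prim-bschramm`, seat `prim-bschramm-p4` (gen 8; PART C3, METHOD = abstract closing argument); helper file (`--supports stmt-CriticalPhenomena-4575
--as helper`).  Memo: `HOME/bschramm/P4-GENERAL.md` §22.  Side-on series: `LineSkeletonSign`, `LineSkeletonSignCyl`, `BoxProdZdTubes`, `FreeNilpotentZSign`.

THE POINT.  On the right Cayley graph `Cay(H₃(ℤ); S)` (tree: `HeisGens.graph S`, p3) the `a`-coordinate `ψ(x, y, z) = x` is 1-Lipschitz (unit steps of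
`S`) with unit steps `· a^{±1}`, left translations are ψ-translating frames (ONE type), the strips `{|x| ≤ ℓ}` are p4-g3's `a`-SLABS — connected already for
the standard generators (`heisSlabAGraph_connected`, p220054), hence for every `S ⊇ {a, b}` — and ONE graph automorphism fixing `1` with `x ↦ −x`
completes a `LineSkeletonNeg`.  Then `BoxProdZdTubes` (Φ2 at `p_c` by tubes; the strips are thick, no transverse coordinate) gives
**`SamePDropOfSkeletonSign₁ → ∀ v, θ_{Cay(H₃; S) □ ℤ}(v, p_c) = 0`** (`HeisGens.heisGensZ_criticalContinuity_of_signNode₁`).  INSTANCE: `S₂ = {a, b, ab, ba}^±`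
(`HeisABBA.X₂`): its own planar skeleton has the central inversion `negIso = (x,y,z) ↦ (−x,−y,z)` only (tier 3b, p4-g6/p5-g6: the Klein four-group sits off
the axes), but `negIso` reverses `x`, so `X₂ □ ℤ = Cay(H₃ × ℤ; a, b, ab, ba, t)` IS a single-type D″ customer (`heisABBAZ_criticalContinuity_of_signNode₁`).
* §1 **`HeisGens.lineX`** — the one-type `LineSkeletonNeg (graph S)` from: `S` symmetric, `a, b ∈ S`, unit steps, an automorphism `f` with `f 1 = 1`,
  `(f g).1 = −g.1`;
* §2 **`HeisGens.heisGensZ_criticalContinuity_of_signNode₁`** (and the multi-type form);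
* §3 the instance `S₂`: **`heisABBAZ_criticalContinuity_of_signNode₁ : SamePDropOfSkeletonSign₁ → ∀ v, θ_{X₂ □ ℤ}(v, p_c) = 0`**.
[cite: BenjaminiSchramm1996, Conj. 4; §2 (Cayley graphs)] [cite: KozmaNitzan2024, §4 p. 16 (Lemma 8)] [cite: CheegerKleinerNaor2011, §1.1 (H₃(ℤ), a, b)]
[cite: MartineauSevero2019, Cor. 2.2]
-/

noncomputable section

namespace Summit.CriticalPhenomena.PercolationContinuityZ3.Theorems.Transplant

namespace HeisGens

open MeasureTheory Literature.Probability.Percolation Literature.Probability.LatticeModels SimpleGraph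
open Literature.Geometry.MetricEmbeddings (cayleyGraph heisMul genA genB heisInv heisMul_zero_right)
open scoped Classical

variable {S : Finset (ℤ × ℤ × ℤ)}

/-! ## §1 The one-dimensional reflectable skeleton `x` of `Cay(H₃; S)` -/

/-- **`Cay(H₃(ℤ); S)` CARRIES A ONE-TYPE ONE-DIMENSIONAL REFLECTABLE SKELETON** whenever `S` is symmetric with unit planar steps, contains
`a, b`, and the graph has an automorphism fixing `1` and reversing the `a`-coordinate: height `x`, frames = left translations, degree `≤ 2|S|`,
unit steps `· a^{±1}`, strips = the `a`-slabs (connected: p4-g3's `heisSlabAGraph_connected` for `{a, b}`, monotone in the edge set).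
[cite: KozmaNitzan2024, §4 p. 16 (Lemma 8)] [cite: CheegerKleinerNaor2011, §1.1] -/
def lineX (hsymm : ∀ s ∈ S, heisInv s ∈ S) (hA : genA ∈ S) (hB : genB ∈ S) (hunit : ∀ s ∈ S, |s.1| ≤ 1 ∧ |s.2.1| ≤ 1)
    (f : graph S ≃g graph S) (hf0 : f ((0, 0, 0) : ℤ × ℤ × ℤ) = (0, 0, 0)) (hfx : ∀ g : ℤ × ℤ × ℤ, (f g).1 = -g.1) :
    LineSkeletonNeg (graph S) where
  ψ := fun g => g.1
  lip := fun g h hgh => by simpa using abs_heisAb_sub_le_one hsymm hunit hgh 0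
  types := {((0, 0, 0) : ℤ × ℤ × ℤ)}
  frame := fun v => ⟨(0, 0, 0), Finset.mem_singleton_self _, leftIso v, by rw [leftIso_apply]; exact heisMul_zero_right v, fun w => by
    rw [leftIso_apply]; simp [heisMul]; ring⟩
  neg := by
    intro t ht
    rw [Finset.mem_singleton] at ht
    subst ht
    exact ⟨f, hf0, fun w => by rw [hfx]; simp⟩
  Δ := 2 * S.card
  degree_le := degree_le
  step := by
    intro v σ
    rcases Int.units_eq_one_or σ with rfl | rfl
    · exact ⟨heisMul v genA, adj_heisMul hA (by simp [genA]), by simp [heisMul, genA]⟩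
    · exact ⟨heisMul v (heisInv genA), adj_heisMul (hsymm _ hA) (by simp [genA, heisInv]), by simp [heisMul, genA, heisInv]⟩
  strip_connected := by
    intro t ht ℓ hℓ
    rw [Finset.mem_singleton] at ht
    subst ht
    have e : {w : ℤ × ℤ × ℤ | |w.1 - ((0, 0, 0) : ℤ × ℤ × ℤ).1| ≤ (ℓ : ℤ)} = heisSlabA ℓ := by
      ext w; simp [mem_heisSlabA_iff]
    rw [e]
    exact induce_connected_mono (cayleyGraph_le hA hB) _ (heisSlabAGraph_connected hℓ)

/-- The height of `lineX`. [folklore] -/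
@[simp] theorem lineX_ψ (hsymm : ∀ s ∈ S, heisInv s ∈ S) (hA : genA ∈ S) (hB : genB ∈ S) (hunit : ∀ s ∈ S, |s.1| ≤ 1 ∧ |s.2.1| ≤ 1)
    (f : graph S ≃g graph S) (hf0 : f ((0, 0, 0) : ℤ × ℤ × ℤ) = (0, 0, 0)) (hfx : ∀ g : ℤ × ℤ × ℤ, (f g).1 = -g.1) (g : ℤ × ℤ × ℤ) :
    (lineX hsymm hA hB hunit f hf0 hfx).ψ g = g.1 := rfl

/-- The base vertex of `lineX`. [folklore] -/
theorem lineX_types (hsymm : ∀ s ∈ S, heisInv s ∈ S) (hA : genA ∈ S) (hB : genB ∈ S) (hunit : ∀ s ∈ S, |s.1| ≤ 1 ∧ |s.2.1| ≤ 1)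
    (f : graph S ≃g graph S) (hf0 : f ((0, 0, 0) : ℤ × ℤ × ℤ) = (0, 0, 0)) (hfx : ∀ g : ℤ × ℤ × ℤ, (f g).1 = -g.1) :
    (lineX hsymm hA hB hunit f hf0 hfx).types = {((0, 0, 0) : ℤ × ℤ × ℤ)} := rfl

/-! ## §2 The conditional theorems for `Cay(H₃; S) × ℤ` -/

/-- **THEOREM (node of record): `SamePDropOfSkeletonSign₁ → θ_{Cay(H₃; S) □ ℤ}(v, p_c) = 0` at every vertex**, for every symmetric unit-step
`S ∋ a, b` whose Cayley graph has an automorphism reversing the `a`-coordinate — a SINGLE-TYPE D″ customer through the side-on skeleton `(x, t)`,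
Φ2 at `p_c` by tubes. [cite: BenjaminiSchramm1996, Conj. 4] [cite: MartineauSevero2019, Cor. 2.2] -/
theorem heisGensZ_criticalContinuity_of_signNode₁ (hD : SamePDropOfSkeletonSign₁) (hsymm : ∀ s ∈ S, heisInv s ∈ S) (hA : genA ∈ S)
    (hB : genB ∈ S) (hunit : ∀ s ∈ S, |s.1| ≤ 1 ∧ |s.2.1| ≤ 1) (f : graph S ≃g graph S) (hf0 : f ((0, 0, 0) : ℤ × ℤ × ℤ) = (0, 0, 0))
    (hfx : ∀ g : ℤ × ℤ × ℤ, (f g).1 = -g.1) (v : (ℤ × ℤ × ℤ) × Site 1) :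
    theta (graph S □ zdGraph 1) v (criticalProbIOf (graph S □ zdGraph 1) v) = 0 :=
  (lineX hsymm hA hB hunit f hf0 hfx).prodInt_criticalContinuity_of_signNode₁' hD (lineX_types hsymm hA hB hunit f hf0 hfx) v

/-- **… and from the multi-type node** (a fortiori). [cite: BenjaminiSchramm1996, Conj. 4] -/
theorem heisGensZ_criticalContinuity_of_signNode (hD : SamePDropOfSkeletonSign) (hsymm : ∀ s ∈ S, heisInv s ∈ S) (hA : genA ∈ S)
    (hB : genB ∈ S) (hunit : ∀ s ∈ S, |s.1| ≤ 1 ∧ |s.2.1| ≤ 1) (f : graph S ≃g graph S) (hf0 : f ((0, 0, 0) : ℤ × ℤ × ℤ) = (0, 0, 0))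
    (hfx : ∀ g : ℤ × ℤ × ℤ, (f g).1 = -g.1) (v : (ℤ × ℤ × ℤ) × Site 1) :
    theta (graph S □ zdGraph 1) v (criticalProbIOf (graph S □ zdGraph 1) v) = 0 :=
  heisGensZ_criticalContinuity_of_signNode₁ (samePDropOfSkeletonSign₁_of_sign hD) hsymm hA hB hunit f hf0 hfx v

/-- **The flip `(x,y,z) ↦ (−x, y, −z)` qualifies whenever it preserves `S`** (e.g. every admissible `S`). [cite: KozmaNitzan2024, §4 p. 16 (Lemma 8)] -/
theorem heisGensZ_criticalContinuity_of_signNode₁_of_flip (hD : SamePDropOfSkeletonSign₁) (hsymm : ∀ s ∈ S, heisInv s ∈ S) (hA : genA ∈ S)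
    (hB : genB ∈ S) (hunit : ∀ s ∈ S, |s.1| ≤ 1 ∧ |s.2.1| ≤ 1) (hτ : ∀ s ∈ S, SameP.heisFlip s ∈ S) (v : (ℤ × ℤ × ℤ) × Site 1) :
    theta (graph S □ zdGraph 1) v (criticalProbIOf (graph S □ zdGraph 1) v) = 0 :=
  heisGensZ_criticalContinuity_of_signNode₁ hD hsymm hA hB hunit (flipIso hτ) rfl (fun _ => rfl) v

end HeisGens

/-! ## §3 The instance `S₂ = {a, b, ab, ba}^±`: `Cay(H₃ × ℤ; a, b, ab, ba, t)` -/

namespace HeisABBA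

open MeasureTheory Literature.Probability.Percolation Literature.Probability.LatticeModels SimpleGraph
open Literature.Geometry.MetricEmbeddings (heisInv genA genB)

/-- **THEOREM: `SamePDropOfSkeletonSign₁ → θ_{X₂ □ ℤ}(v, p_c) = 0` at every vertex of `Cay(H₃ × ℤ; a, b, ab, ba, t)`** — the `a`-coordinate
reversed by the central inversion `negIso` (`(x,y,z) ↦ (−x,−y,z)`), the `a`-slabs as strips: a single-type D″ customer, although `X₂` itself only
carries the central inversion over its planar skeleton (tier 3b). [cite: BenjaminiSchramm1996, Conj. 4] [cite: MartineauSevero2019, Cor. 2.2] -/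
theorem heisABBAZ_criticalContinuity_of_signNode₁ (hD : SamePDropOfSkeletonSign₁) (v : (ℤ × ℤ × ℤ) × Site 1) :
    theta (X₂ □ zdGraph 1) v (criticalProbIOf (X₂ □ zdGraph 1) v) = 0 :=
  HeisGens.heisGensZ_criticalContinuity_of_signNode₁ hD symm genA_mem genB_mem unit negIso (by rfl) (fun _ => rfl) v

/-- **… and from the multi-type node.** [cite: BenjaminiSchramm1996, Conj. 4] -/
theorem heisABBAZ_criticalContinuity_of_signNode (hD : SamePDropOfSkeletonSign) (v : (ℤ × ℤ × ℤ) × Site 1) :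
    theta (X₂ □ zdGraph 1) v (criticalProbIOf (X₂ □ zdGraph 1) v) = 0 :=
  heisABBAZ_criticalContinuity_of_signNode₁ (samePDropOfSkeletonSign₁_of_sign hD) v

end HeisABBA

end Summit.CriticalPhenomena.PercolationContinuityZ3.Theorems.Transplant

end
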